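import Literature.MathematicalPhysics.QuantumLattice.KohnLuttinger
import Literature.MathematicalPhysics.QuantumLattice.HubbardFermiPolar
import Literature.Geometry.GeometricMeasureTheory.AreaFormula
import Mathlib.Geometry.Euclidean.Volume.Measure
import HarnessLib

/-!
# The Fermi-curve measure of the square lattice in polar coordinates

Topic `Literature/MathematicalPhysics/QuantumLattice`; bridges `KohnLuttinger.lean` (the
density-of-states measure `fermiCurveMeasure ε μ = μH[1]⌊{ε = μ} · ‖∇ε‖⁻¹` of
Raghu–Kivelson–Scalapino 2010, eqs. (6), (8), defined with Mathlib's Hausdorff measure) and the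
polar parametrisation `θ ↦ fermiPolar μ θ = u_μ(θ)(cos θ, sin θ)` of the Fermi curve of
`ε = squareDispersion 1 0` for `-4 < μ < 0` (`HubbardFermiRadiusBand.lean`, `HubbardFermiPolar.lean`),
through the tree's area formula (`Literature.Geometry.GeometricMeasureTheory.AreaFormula`,
Federer 3.2.3/3.2.5 for injective `C¹` immersions):

* `fermiCurve_eq_image` — `fermiCurve ε μ = fermiPolar μ '' (-π, π]`;
* `euclideanHausdorffMeasure_one` — Mathlib's Euclidean normalisation is trivial in dimension
  one: `μHE[1] = μH[1]` (both give length `1` to a unit segment);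
* `map_fermiPolar_withDensity_speed` — **arc length in polar coordinates**:
  `(fermiPolar μ)_* (‖γ'‖ dθ ⌞ (-π, π]) = μH[1] ⌞ fermiCurve ε μ`;
* `gradient_squareDispersion`, `norm_gradient_squareDispersion` — `∇ε(k) = 2(sin k₀, sin k₁)`;
* `fermiCurveMeasure_eq_map` — **the density-of-states measure in polar coordinates**:
  `fermiCurveMeasure ε μ = (fermiPolar μ)_* (fermiPolarDOS μ · dθ ⌞ (-π, π])`,
  `fermiPolarDOS = ‖γ'(θ)‖ / ‖∇ε(γ(θ))‖`, i.e.
  `∫ f dμ_F = ∫_{-π}^{π} f(γ(θ)) ‖γ'(θ)‖/‖∇ε(γ(θ))‖ dθ` (RKS eq. (8): `dk̂/v_F`).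

Everything is proved; no definitions. [folklore]

## Sources

S. Raghu, S. A. Kivelson, D. J. Scalapino, Phys. Rev. B 81 (2010) 224505, §II eqs. (6), (8)
(`RaghuKivelsonScalapino2010`); H. Federer, *Geometric Measure Theory* (1969) 3.2.3
(`Federer1969`, via the tree's `AreaFormula`).
-/

noncomputable section

open Real Set Filter MeasureTheory MeasureTheory.Measure
open scoped Topology ENNReal RealInnerProductSpace

namespace Literature.MathematicalPhysics.QuantumLattice

/-! ### The dispersion on `EuclideanSpace` versus `Fin 2 → ℝ` -/

/-- `squareDispersion 1 0 k = sqDispersion (ofLp k)` (`= -2(cos k₀ + cos k₁)`). [folklore] -/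
theorem squareDispersion_one_zero_eq_sqDispersion (k : Momentum) :
    squareDispersion 1 0 k = sqDispersion (WithLp.ofLp k) := by
  simp [squareDispersion, sqDispersion]

/-! ### The Fermi curve is the image of the polar parametrisation -/

section Curve

variable {μ : ℝ} (hμ₁ : -4 < μ) (hμ₂ : μ < 0)
include hμ₁ hμ₂

/-- Polar points lie on the Fermi curve. [folklore] -/
theorem fermiPolar_mem_fermiCurve (θ : ℝ) : fermiPolar μ θ ∈ fermiCurve (squareDispersion 1 0) μ := by
  refine ⟨fun i => ?_, ?_⟩
  · have h := abs_fermiPolar_apply_lt hμ₁ hμ₂ θ i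
    rw [abs_lt] at h
    exact ⟨h.1.le, h.2⟩
  · rw [squareDispersion_one_zero_eq_sqDispersion]
    exact sqDispersion_ofLp_fermiPolar hμ₁ hμ₂ θ

/-- **The Fermi curve is the polar image of `(-π, π]`**: `fermiCurve ε μ = fermiPolar μ '' Ioc (-π) π`
for `ε = squareDispersion 1 0`, `-4 < μ < 0`. [folklore] -/
theorem fermiCurve_eq_image :
    fermiCurve (squareDispersion 1 0) μ = fermiPolar μ '' Ioc (-π) π := by
  ext k
  constructor
  · rintro ⟨hk, he⟩
    have hnorm : ‖WithLp.ofLp k‖ ≤ π := by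
      refine (pi_norm_le_iff_of_nonneg Real.pi_pos.le).2 fun i => ?_
      rw [Real.norm_eq_abs, abs_le]
      exact ⟨(hk i).1, (hk i).2.le⟩
    rw [squareDispersion_one_zero_eq_sqDispersion] at he
    obtain ⟨θ, hθ, rfl⟩ := exists_fermiPolar_eq hμ₁ hμ₂ hnorm he
    exact ⟨θ, hθ, rfl⟩
  · rintro ⟨θ, -, rfl⟩
    exact fermiPolar_mem_fermiCurve hμ₁ hμ₂ θ

/-- The Fermi curve is the full range of the polar parametrisation. [folklore] -/
theorem fermiCurve_eq_range : fermiCurve (squareDispersion 1 0) μ = range (fermiPolar μ) := by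
  apply Subset.antisymm
  · rw [fermiCurve_eq_image hμ₁ hμ₂]; exact image_subset_range _ _
  · rintro _ ⟨θ, rfl⟩; exact fermiPolar_mem_fermiCurve hμ₁ hμ₂ θ

/-- The Fermi curve is compact. [folklore] -/
theorem isCompact_fermiCurve : IsCompact (fermiCurve (squareDispersion 1 0) μ) := by
  have h : fermiCurve (squareDispersion 1 0) μ = fermiPolar μ '' Icc (-π) π := by
    apply Subset.antisymm
    · rw [fermiCurve_eq_image hμ₁ hμ₂]; exact image_mono Ioc_subset_Icc_self
    · rintro _ ⟨θ, -, rfl⟩; exact fermiPolar_mem_fermiCurve hμ₁ hμ₂ θ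
  rw [h]
  exact isCompact_Icc.image (continuous_fermiPolar hμ₁ hμ₂)

/-- The Fermi curve is measurable. [folklore] -/
theorem measurableSet_fermiCurve : MeasurableSet (fermiCurve (squareDispersion 1 0) μ) :=
  (isCompact_fermiCurve hμ₁ hμ₂).isClosed.measurableSet

end Curve

/-! ### `μHE[1] = μH[1]` -/

/-- **In dimension one Mathlib's Euclidean normalisation of the Hausdorff measure is trivial**:
`μHE[1] = μH[1]` on every Borel (e)metric space (the normalising constant is fixed on
`EuclideanSpace ℝ (Fin 1)`, where both `μHE[1] = volume` and `μH[1]` give measure `1` to the unit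
segment `[0, e₀]`). [folklore] -/
theorem euclideanHausdorffMeasure_one {X : Type*} [EMetricSpace X] [MeasurableSpace X] [BorelSpace X] :
    (μHE[1] : Measure X) = μH[1] := by
  have key : addHaarScalarFactor (volume : Measure (EuclideanSpace ℝ (Fin 1)))
      (μH[((1 : ℕ) : ℝ)] : Measure (EuclideanSpace ℝ (Fin 1))) = 1 := by
    have h := EuclideanSpace.euclideanHausdorffMeasure_eq_volume 1
    rw [euclideanHausdorffMeasure_def] at h
    set v : EuclideanSpace ℝ (Fin 1) := EuclideanSpace.single 0 1 with hv
    set S : Set (EuclideanSpace ℝ (Fin 1)) := affineSegment ℝ 0 v with hS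
    -- evaluate `c • μH[1] = volume` on the unit segment `S = [0, v]`
    have h1 := congrArg (fun m : Measure (EuclideanSpace ℝ (Fin 1)) => m S) h
    simp only [Measure.smul_apply] at h1
    have hdist : edist (0 : EuclideanSpace ℝ (Fin 1)) v = 1 := by
      rw [edist_eq_enorm_sub, zero_sub, enorm_neg, ← ofReal_norm, hv, PiLp.norm_single, norm_one,
        ENNReal.ofReal_one]
    have hH : (μH[((1 : ℕ) : ℝ)] : Measure (EuclideanSpace ℝ (Fin 1))) S = 1 := by
      rw [Nat.cast_one, hS, hausdorffMeasure_affineSegment, hdist]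
    -- the segment is the parallelepiped of the orthonormal basis `{v}`
    have hseg : S = parallelepiped (EuclideanSpace.basisFun (Fin 1) ℝ) := by
      ext x
      rw [mem_parallelepiped_iff, hS, affineSegment, Set.mem_image]
      constructor
      · rintro ⟨t, ht, rfl⟩
        refine ⟨fun _ => t, ⟨fun _ => ht.1, fun _ => ht.2⟩, ?_⟩
        simp [hv, AffineMap.lineMap_apply_module]
      · rintro ⟨t, ht, rfl⟩
        refine ⟨t 0, ⟨ht.1 0, ht.2 0⟩, ?_⟩
        simp [hv, AffineMap.lineMap_apply_module]
    have hvol : volume S = 1 := by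
      rw [hseg]; exact (EuclideanSpace.basisFun (Fin 1) ℝ).volume_parallelepiped
    rw [hH, hvol, ENNReal.smul_def, smul_eq_mul, mul_one, ENNReal.coe_eq_one] at h1
    exact h1
  rw [euclideanHausdorffMeasure_def, key, one_smul, Nat.cast_one]

/-! ### Arc length in polar coordinates (the area formula, `n = 1`) -/

/-- Pushing a `withDensity` through a `map`: `(F_* ν).withDensity w = F_* (ν.withDensity (w ∘ F))`
for measurable `F`, `w`. [folklore] -/
theorem withDensity_map_eq_map_withDensity_comp {α β : Type*} [MeasurableSpace α] [MeasurableSpace β]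
    {F : α → β} (hF : Measurable F) (ν : Measure α) {w : β → ℝ≥0∞} (hw : Measurable w) :
    (Measure.map F ν).withDensity w = Measure.map F (ν.withDensity (w ∘ F)) := by
  ext s hs
  rw [withDensity_apply _ hs, Measure.map_apply hF hs, withDensity_apply _ (hF hs),
    ← lintegral_indicator hs, lintegral_map (hw.indicator hs) hF, ← lintegral_indicator (hF hs)]
  congr 1

section ArcLength

variable {μ : ℝ} (hμ₁ : -4 < μ) (hμ₂ : μ < 0)
include hμ₁ hμ₂

/-- **Arc length of the Fermi curve in polar coordinates, local form** (the tree's area formula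
with `P = ℝ`, `n = 1`): for a measurable `S` inside an open interval `U` of length `≤ 2π`,
`(fermiPolar μ)_* (‖γ'‖ dθ ⌞ S) = μH[1] ⌞ fermiPolar μ (S)`. [cite: Federer1969, 3.2.3] -/
theorem map_fermiPolar_withDensity_speed_of_subset {a b : ℝ} (hab : b - a ≤ 2 * π) {S : Set ℝ}
    (hS : MeasurableSet S) (hSU : S ⊆ Ioo a b) :
    Measure.map (fermiPolar μ) ((volume.restrict S).withDensity fun θ =>
        ENNReal.ofReal ‖fermiPolarVelocity μ θ‖) =
      (μH[1] : Measure Momentum).restrict (fermiPolar μ '' S) := by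
  set v : ℝ → Momentum := fermiPolarVelocity μ with hv
  set F' : ℝ → ℝ →L[ℝ] Momentum := fun θ => ContinuousLinearMap.smulRight (1 : ℝ →L[ℝ] ℝ) (v θ)
    with hF'
  have hF : ∀ θ ∈ Ioo a b, HasFDerivAt (fermiPolar μ) (F' θ) θ := fun θ _ =>
    (hasDerivAt_fermiPolar hμ₁ hμ₂ θ).hasFDerivAt
  have hvc : Continuous v := continuous_fermiPolarVelocity hμ₁ hμ₂
  have hF'c : ContinuousOn F' (Ioo a b) := by
    have : F' = fun θ => ContinuousLinearMap.smulRightL ℝ ℝ Momentum (1 : ℝ →L[ℝ] ℝ) (v θ) := by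
      funext θ; rfl
    rw [this]
    exact ((ContinuousLinearMap.smulRightL ℝ ℝ Momentum (1 : ℝ →L[ℝ] ℝ)).continuous.comp hvc).continuousOn
  have hinj : InjOn (fermiPolar μ) (Ioo a b) := injOn_fermiPolar_Ioo hμ₁ hμ₂ hab
  have himm : ∀ θ ∈ Ioo a b, Function.Injective (F' θ) := fun θ _ => by
    intro s t hst
    have hst' : s • v θ = t • v θ := by simpa [hF'] using hst
    exact smul_left_injective ℝ (fermiPolarVelocity_ne_zero hμ₁ hμ₂ θ) hst'
  have key := Literature.Geometry.GeometricMeasureTheory.map_withDensity_sqrt_det_gram_eq_restrict_image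
    (OrthonormalBasis.singleton (Fin 1) ℝ) isOpen_Ioo hF hF'c hinj himm hS hSU
  -- the `1 × 1` Gram determinant is `‖v θ‖²`
  have hF'1 : ∀ θ : ℝ, F' θ 1 = v θ := fun θ => by simp [hF']
  convert key using 3
  · funext θ
    show ENNReal.ofReal ‖v θ‖ = ENNReal.ofReal (Real.sqrt (Matrix.of fun i j : Fin 1 =>
      ⟪F' θ (OrthonormalBasis.singleton (Fin 1) ℝ i), F' θ (OrthonormalBasis.singleton (Fin 1) ℝ j)⟫).det)
    rw [Matrix.det_fin_one, Matrix.of_apply, OrthonormalBasis.singleton_apply, hF'1,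
      real_inner_self_eq_norm_sq, Real.sqrt_sq (norm_nonneg _)]
  · rw [Module.finrank_self, euclideanHausdorffMeasure_one]

/-- **Arc length of the Fermi curve in polar coordinates**:
`(fermiPolar μ)_* (‖γ'‖ dθ ⌞ (-π, π]) = μH[1] ⌞ fermiCurve ε μ`. [cite: Federer1969, 3.2.3] -/
theorem map_fermiPolar_withDensity_speed :
    Measure.map (fermiPolar μ) ((volume.restrict (Ioc (-π) π)).withDensity fun θ =>
        ENNReal.ofReal ‖fermiPolarVelocity μ θ‖) =
      (μH[1] : Measure Momentum).restrict (fermiCurve (squareDispersion 1 0) μ) := by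
  set ρ : ℝ → ℝ≥0∞ := fun θ => ENNReal.ofReal ‖fermiPolarVelocity μ θ‖ with hρ
  have hπ := Real.pi_pos
  -- two half-turn pieces, each inside an open interval of length `< 2π`
  have h2π := Real.two_le_pi
  have hS1 : Ioc (-π) 0 ⊆ Ioo (-π) 1 := fun θ hθ => ⟨hθ.1, by linarith [hθ.2]⟩
  have hS2 : Ioc 0 π ⊆ Ioo 0 (π + 1) := fun θ hθ => ⟨hθ.1, by linarith [hθ.2]⟩
  have h1 := map_fermiPolar_withDensity_speed_of_subset hμ₁ hμ₂ (a := -π) (b := 1)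
    (by linarith) measurableSet_Ioc hS1
  have h2 := map_fermiPolar_withDensity_speed_of_subset hμ₁ hμ₂ (a := 0) (b := π + 1)
    (by linarith) measurableSet_Ioc hS2
  have hunion : Ioc (-π) π = Ioc (-π) 0 ∪ Ioc 0 π := (Ioc_union_Ioc_eq_Ioc (by linarith) hπ.le).symm
  have hdisj : Disjoint (Ioc (-π) (0 : ℝ)) (Ioc 0 π) :=
    Set.disjoint_left.2 fun θ h1 h2 => lt_irrefl _ (h1.2.trans_lt h2.1)
  -- the images are disjoint (injectivity on `(-π, π]`) and cover the curve
  have hinj : InjOn (fermiPolar μ) (Ioc (-π) π) := by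
    refine injOn_fermiPolar hμ₁ hμ₂ fun θ₁ h₁ θ₂ h₂ => ?_
    rw [abs_lt]; constructor <;> linarith [h₁.1, h₁.2, h₂.1, h₂.2]
  have hdisj' : Disjoint (fermiPolar μ '' Ioc (-π) 0) (fermiPolar μ '' Ioc 0 π) := by
    rw [Set.disjoint_left]
    rintro _ ⟨θ₁, h₁, rfl⟩ ⟨θ₂, h₂, heq⟩
    have hm₂ : θ₂ ∈ Ioc (-π) π := ⟨by linarith [h₂.1], h₂.2⟩
    have hm₁ : θ₁ ∈ Ioc (-π) π := ⟨h₁.1, by linarith [h₁.2]⟩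
    have := hinj hm₂ hm₁ heq
    rw [this] at h₂
    exact lt_irrefl _ (h₁.2.trans_lt h₂.1)
  have hcurve : fermiCurve (squareDispersion 1 0) μ = fermiPolar μ '' Ioc (-π) 0 ∪ fermiPolar μ '' Ioc 0 π := by
    rw [fermiCurve_eq_image hμ₁ hμ₂, hunion, image_union]
  have hmeasI : MeasurableSet (fermiPolar μ '' Ioc 0 π) :=
    measurableSet_Ioc.image_of_continuousOn_injOn (continuous_fermiPolar hμ₁ hμ₂).continuousOn
      (Set.InjOn.mono (fun θ (hθ : θ ∈ Ioc 0 π) => (⟨by linarith [hθ.1], hθ.2⟩ : θ ∈ Ioc (-π) π)) hinj)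
  have hFm : Measurable (fermiPolar μ) := (continuous_fermiPolar hμ₁ hμ₂).measurable
  calc Measure.map (fermiPolar μ) ((volume.restrict (Ioc (-π) π)).withDensity ρ)
      = Measure.map (fermiPolar μ) ((volume.restrict (Ioc (-π) 0)).withDensity ρ +
          (volume.restrict (Ioc 0 π)).withDensity ρ) := by
        rw [hunion, Measure.restrict_union hdisj measurableSet_Ioc, withDensity_add_measure]
    _ = Measure.map (fermiPolar μ) ((volume.restrict (Ioc (-π) 0)).withDensity ρ) +
          Measure.map (fermiPolar μ) ((volume.restrict (Ioc 0 π)).withDensity ρ) :=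
        Measure.map_add _ _ hFm
    _ = (μH[1] : Measure Momentum).restrict (fermiPolar μ '' Ioc (-π) 0) +
          (μH[1] : Measure Momentum).restrict (fermiPolar μ '' Ioc 0 π) := by rw [h1, h2]
    _ = (μH[1] : Measure Momentum).restrict (fermiPolar μ '' Ioc (-π) 0 ∪ fermiPolar μ '' Ioc 0 π) :=
        (Measure.restrict_union hdisj' hmeasI).symm
    _ = (μH[1] : Measure Momentum).restrict (fermiCurve (squareDispersion 1 0) μ) := by rw [hcurve]

end ArcLength

/-! ### The gradient of the dispersion -/

/-- **`∇ε(k) = (2 sin k₀, 2 sin k₁)`** for `ε = squareDispersion 1 0 = -2(cos k₀ + cos k₁)` on the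
Euclidean plane. [folklore] -/
theorem hasGradientAt_squareDispersion (k : Momentum) :
    HasGradientAt (squareDispersion 1 0) (WithLp.toLp 2 ![2 * Real.sin (k 0), 2 * Real.sin (k 1)]) k := by
  rw [hasGradientAt_iff_hasFDerivAt]
  -- the derivative as a combination of the coordinate projections
  set P0 : Momentum →L[ℝ] ℝ := PiLp.proj 2 (fun _ : Fin 2 => ℝ) (0 : Fin 2) with hP0
  set P1 : Momentum →L[ℝ] ℝ := PiLp.proj 2 (fun _ : Fin 2 => ℝ) (1 : Fin 2) with hP1
  have hc0 : HasDerivAt Real.cos (-Real.sin (k 0)) (P0 k) := Real.hasDerivAt_cos (k 0)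
  have hc1 : HasDerivAt Real.cos (-Real.sin (k 1)) (P1 k) := Real.hasDerivAt_cos (k 1)
  have h0 : HasFDerivAt (Real.cos ∘ ⇑P0) (-Real.sin (k 0) • P0) k := hc0.comp_hasFDerivAt k P0.hasFDerivAt
  have h1 : HasFDerivAt (Real.cos ∘ ⇑P1) (-Real.sin (k 1) • P1) k := hc1.comp_hasFDerivAt k P1.hasFDerivAt
  have h := (h0.add h1).const_mul (-2 : ℝ)
  have hfun : squareDispersion 1 0 = fun q : Momentum => (-2 : ℝ) * (Real.cos ∘ ⇑P0 + Real.cos ∘ ⇑P1) q := by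
    funext q; simp [squareDispersion, hP0, hP1]
  rw [hfun]
  refine h.congr_fderiv ?_
  ext q
  rw [InnerProductSpace.toDual_apply_apply]
  simp [hP0, hP1, PiLp.inner_apply, Fin.sum_univ_two]
  ring

/-- `gradient ε k = (2 sin k₀, 2 sin k₁)`. [folklore] -/
theorem gradient_squareDispersion (k : Momentum) :
    gradient (squareDispersion 1 0) k = WithLp.toLp 2 ![2 * Real.sin (k 0), 2 * Real.sin (k 1)] :=
  (hasGradientAt_squareDispersion k).gradient

/-- `‖∇ε(k)‖ = 2 √(sin² k₀ + sin² k₁)`. [folklore] -/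
theorem norm_gradient_squareDispersion (k : Momentum) :
    ‖gradient (squareDispersion 1 0) k‖ = 2 * Real.sqrt (Real.sin (k 0) ^ 2 + Real.sin (k 1) ^ 2) := by
  rw [gradient_squareDispersion, EuclideanSpace.norm_eq, Fin.sum_univ_two]
  simp only [Matrix.cons_val_zero, Matrix.cons_val_one, Real.norm_eq_abs, sq_abs]
  rw [show (2 * Real.sin (k 0)) ^ 2 + (2 * Real.sin (k 1)) ^ 2 =
      2 ^ 2 * (Real.sin (k 0) ^ 2 + Real.sin (k 1) ^ 2) by ring,
    Real.sqrt_mul (by norm_num), Real.sqrt_sq (by norm_num)]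

/-- The gradient is a continuous vector field. [folklore] -/
theorem continuous_gradient_squareDispersion : Continuous (gradient (squareDispersion 1 0)) := by
  have : gradient (squareDispersion 1 0) = fun k : Momentum =>
      WithLp.toLp 2 ![2 * Real.sin (k 0), 2 * Real.sin (k 1)] := funext gradient_squareDispersion
  rw [this]
  refine (PiLp.continuous_toLp 2 _).comp (continuous_pi fun i => ?_)
  have h0 : Continuous fun a : Momentum => 2 * Real.sin (a 0) :=
    continuous_const.mul (Real.continuous_sin.comp (PiLp.continuous_apply 2 _ (0 : Fin 2)))
  have h1 : Continuous fun a : Momentum => 2 * Real.sin (a 1) :=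
    continuous_const.mul (Real.continuous_sin.comp (PiLp.continuous_apply 2 _ (1 : Fin 2)))
  fin_cases i
  · simpa using h0
  · simpa using h1

/-- The inverse Fermi speed `‖∇ε‖⁻¹` is a measurable weight. [folklore] -/
theorem measurable_invFermiSpeed :
    Measurable fun k : Momentum => ENNReal.ofReal (‖gradient (squareDispersion 1 0) k‖⁻¹) :=
  ENNReal.measurable_ofReal.comp (continuous_gradient_squareDispersion.norm.measurable.inv)

/-! ### The density-of-states measure in polar coordinates -/

/-- The norm of the gradient at a polar point, in terms of the polar data. [folklore] -/
theorem norm_gradient_squareDispersion_fermiPolar (μ θ : ℝ) :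
    ‖gradient (squareDispersion 1 0) (fermiPolar μ θ)‖ =
      2 * Real.sqrt (Real.sin (fermiPolar μ θ 0) ^ 2 + Real.sin (fermiPolar μ θ 1) ^ 2) :=
  norm_gradient_squareDispersion _

/-- `fermiPolarDOS μ θ = ‖γ'(θ)‖ · ‖∇ε(γ θ)‖⁻¹`. [folklore] -/
theorem fermiPolarDOS_eq (μ θ : ℝ) :
    fermiPolarDOS μ θ = ‖fermiPolarVelocity μ θ‖ * ‖gradient (squareDispersion 1 0) (fermiPolar μ θ)‖⁻¹ := by
  rw [fermiPolarDOS, norm_gradient_squareDispersion_fermiPolar, div_eq_mul_inv]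

section DOS

variable {μ : ℝ} (hμ₁ : -4 < μ) (hμ₂ : μ < 0)
include hμ₁ hμ₂

/-- **The Fermi-curve (density-of-states) measure in polar coordinates**:
`fermiCurveMeasure ε μ = (fermiPolar μ)_* (fermiPolarDOS μ · dθ ⌞ (-π, π])`, i.e. for every
measurable `f ≥ 0`, `∫ f dμ_F = ∫_{(-π,π]} f(γ θ) ‖γ'(θ)‖/‖∇ε(γ θ)‖ dθ` — RKS eq. (8) (`dk̂ / v_F`)
for `ε = squareDispersion 1 0`, `-4 < μ < 0`. [cite: RaghuKivelsonScalapino2010, §II (6) and (8)] -/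
theorem fermiCurveMeasure_eq_map :
    fermiCurveMeasure (squareDispersion 1 0) μ =
      Measure.map (fermiPolar μ) ((volume.restrict (Ioc (-π) π)).withDensity fun θ =>
        ENNReal.ofReal (fermiPolarDOS μ θ)) := by
  have hFm : Measurable (fermiPolar μ) := (continuous_fermiPolar hμ₁ hμ₂).measurable
  have hρ : Measurable fun θ : ℝ => ENNReal.ofReal ‖fermiPolarVelocity μ θ‖ :=
    ENNReal.measurable_ofReal.comp (continuous_fermiPolarVelocity hμ₁ hμ₂).norm.measurable
  have hdens : (fun θ : ℝ => ENNReal.ofReal (fermiPolarDOS μ θ)) =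
      (fun θ : ℝ => ENNReal.ofReal ‖fermiPolarVelocity μ θ‖) *
        ((fun k : Momentum => ENNReal.ofReal (‖gradient (squareDispersion 1 0) k‖⁻¹)) ∘ fermiPolar μ) := by
    funext θ
    simp only [Pi.mul_apply, Function.comp_apply]
    rw [fermiPolarDOS_eq, ENNReal.ofReal_mul (norm_nonneg _)]
  unfold fermiCurveMeasure
  rw [← map_fermiPolar_withDensity_speed hμ₁ hμ₂,
    withDensity_map_eq_map_withDensity_comp hFm _ measurable_invFermiSpeed,
    ← withDensity_mul _ hρ (measurable_invFermiSpeed.comp hFm), hdens]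

end DOS

end Literature.MathematicalPhysics.QuantumLattice

end
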